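import Mathlib
import HarnessLib

/-!
# Compacta of an open connected set are joined to a base point far from a closed set

Topic `Literature/Probability/RandomPlanarGeometry` (planar domains; stated for `ℂ`). The
compactness step behind the connectivity of the bulk of the lattice approximations of a planar
domain and of its exterior (Bollobás–Riordan, *Percolation* (2006), Ch. 7, Lemma 16 p. 185 and
its uses on pp. 190–199): inside an open connected set `U`, every point of a compact `K ⊆ U` is
joined to a base point by a path of `U` keeping a uniform positive distance from a closed set
`F` disjoint from `U` (e.g. the frontier of `U`).

* `exists_joined_far_of_isCompact_of_isOpen` — the statement above (finitely many balls inside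
  `U` cover `K`, their centres are joined to the base point in the path-connected `U`, a point
  of a small ball is first joined to its centre inside the ball; compactness of the paths gives
  the margin).

## References

* B. Bollobás, O. Riordan, *Percolation*, Cambridge University Press (2006), Ch. 7, Lemma 16
  p. 185, p. 199.
-/

noncomputable section

open Set Filter Topology Metric

namespace Literature.Probability.RandomPlanarGeometry

/-- **Compacta of an open connected set are joined to a base point far from a disjoint closed
set.** For `U ⊆ ℂ` open and connected, `F` closed, nonempty and disjoint from `U`, `z ∈ U` and a
compact `K ⊆ U`, there is `η > 0` such that every `x ∈ K` is joined to `z` by a path of `U` all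
of whose points are at distance `> η` from `F`. [cite: BollobasRiordan2006, Ch. 7 Lemma 16 p. 185] -/
theorem exists_joined_far_of_isCompact_of_isOpen {U F K : Set ℂ} (hU : IsOpen U) (hUc : IsConnected U)
    (hF : IsClosed F) (hFne : F.Nonempty) (hUF : Disjoint U F) {z : ℂ} (hz : z ∈ U) (hK : IsCompact K) (hKU : K ⊆ U) :
    ∃ η > 0, ∀ x ∈ K, ∃ γ : Path x z, ∀ t, γ t ∈ U ∧ η < infDist (γ t) F := by
  classical
  -- points of `U` are at positive distance from `F`
  have hpos : ∀ p ∈ U, 0 < infDist p F := fun p hp =>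
    (hF.notMem_iff_infDist_pos hFne).1 (fun hpF => hUF.le_bot ⟨hp, hpF⟩)
  -- balls inside `U` around the points of `K`
  have hball : ∀ x ∈ K, ∃ r > 0, ball x r ⊆ U := fun x hx => Metric.isOpen_iff.1 hU x (hKU hx)
  choose! r hr hrU using hball
  obtain ⟨T, hTsub, hTfin, hTcov⟩ :=
    hK.elim_finite_subcover_image (b := K) (c := fun x : ℂ => ball x (r x / 2))
      (fun x _ => isOpen_ball) (fun x hx => mem_iUnion₂.2 ⟨x, hx, mem_ball_self (by have := hr x hx; positivity)⟩)
  -- the centres are joined to `z` inside `U`, far from `F`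
  have hpc : IsPathConnected U := (hU.isConnected_iff_isPathConnected).1 hUc
  have hpt : ∀ x (hx : x ∈ T), ∃ γ : Path x z, ∃ η : ℝ, 0 < η ∧ ∀ t, γ t ∈ U ∧ η < infDist (γ t) F := by
    intro x hx
    obtain ⟨γ, hγ⟩ := hpc.joinedIn x (hKU (hTsub hx)) z hz
    have hcont : Continuous fun t => infDist (γ t) F := (continuous_infDist_pt _).comp γ.continuous
    obtain ⟨t₀, -, ht₀⟩ := isCompact_univ.exists_isMinOn univ_nonempty hcont.continuousOn
    have h0 := hpos _ (hγ t₀)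
    refine ⟨γ, infDist (γ t₀) F / 2, by positivity, fun t => ⟨hγ t, ?_⟩⟩
    have := ht₀ (mem_univ t)
    simp only [mem_setOf_eq] at this
    linarith
  choose g η hηpos hg using hpt
  -- points of a small ball are in `U`, far from `F`
  have hfar_ball : ∀ x ∈ T, ∀ p ∈ ball x (r x / 2), p ∈ U ∧ r x / 2 ≤ infDist p F := by
    intro x hx p hp
    have hxK := hTsub hx
    refine ⟨hrU x hxK (ball_subset_ball (by linarith [hr x hxK]) hp), ?_⟩
    refine (le_infDist hFne).2 fun f hf => ?_
    by_contra hlt; push Not at hlt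
    have hfball : f ∈ ball x (r x) := by
      rw [mem_ball] at hp ⊢
      calc dist f x ≤ dist f p + dist p x := dist_triangle _ _ _
        _ < r x / 2 + r x / 2 := by rw [dist_comm] at hlt; exact add_lt_add hlt hp
        _ = r x := by ring
    exact hUF.le_bot ⟨hrU x hxK hfball, hf⟩
  by_cases hT : T.Nonempty
  · obtain ⟨x₁, hx₁, hmin₁⟩ := T.exists_min_image (fun x => if hx : x ∈ T then η x hx else 0) hTfin hT
    obtain ⟨x₂, hx₂, hmin₂⟩ := T.exists_min_image (fun x => r x / 2) hTfin hT
    refine ⟨min (η x₁ hx₁) (r x₂ / 2) / 2, by have := hηpos x₁ hx₁; have := hr x₂ (hTsub hx₂); positivity,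
      fun x hx => ?_⟩
    obtain ⟨c, hc, hxc⟩ : ∃ c ∈ T, x ∈ ball c (r c / 2) := by simpa only [mem_iUnion, exists_prop] using hTcov hx
    have hconv : IsPathConnected (ball c (r c / 2)) :=
      (convex_ball c (r c / 2)).isPathConnected ⟨c, mem_ball_self (by have := hr c (hTsub hc); positivity)⟩
    obtain ⟨γ₁, hγ₁⟩ := hconv.joinedIn x hxc c (mem_ball_self (by have := hr c (hTsub hc); positivity))
    refine ⟨γ₁.trans (g c hc), fun t => ?_⟩
    have hmem : (γ₁.trans (g c hc)) t ∈ range γ₁ ∪ range (g c hc) := by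
      rw [← Path.trans_range]; exact mem_range_self t
    have hη₁ : min (η x₁ hx₁) (r x₂ / 2) / 2 < η c hc := by
      have h1 := hmin₁ c hc
      simp only [dif_pos hx₁, dif_pos hc] at h1
      have h2 : 0 < η x₁ hx₁ := hηpos x₁ hx₁
      have h3 : min (η x₁ hx₁) (r x₂ / 2) ≤ η x₁ hx₁ := min_le_left _ _
      linarith
    have hr₁ : min (η x₁ hx₁) (r x₂ / 2) / 2 < r c / 2 := by
      have h1 : r x₂ / 2 ≤ r c / 2 := hmin₂ c hc
      have h2 : 0 < r x₂ := hr x₂ (hTsub hx₂)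
      have h3 : min (η x₁ hx₁) (r x₂ / 2) ≤ r x₂ / 2 := min_le_right _ _
      linarith
    rcases hmem with ⟨s, hs⟩ | ⟨s, hs⟩
    · rw [← hs]
      obtain ⟨hU', hfar⟩ := hfar_ball c hc _ (hγ₁ s)
      exact ⟨hU', lt_of_lt_of_le hr₁ hfar⟩
    · rw [← hs]
      exact ⟨(hg c hc s).1, hη₁.trans (hg c hc s).2⟩
  · rw [Set.not_nonempty_iff_eq_empty] at hT
    refine ⟨1, one_pos, fun x hx => ?_⟩
    have := hTcov hx
    simp [hT] at this

end Literature.Probability.RandomPlanarGeometry
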